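import Literature.NumberTheory.FaltingsSerre.ResidualFrobeniusData
import Mathlib.FieldTheory.Separable
import HarnessLib

/-!
# Venture ResidMod — instance kit: numeral forms of `L_q(A,T) = 1 − aT + bT² − qaT³ + q²T⁴` and its
# derivative over `ℚ`, and separability from an integer Bézout identity

HONEST FRAMING. Theorems only; bookkeeping used by the per-surface instance files of the cell
`pub-residmod` to discharge the numeric slot DIST0(3) ("the characteristic polynomial of Frobenius at `3`
has no repeated roots", BCGP 2025 Thm. 1.1.1 (3)) in the form the verdict
`modular_of_mod3SurjectiveCertificate_of_bcgp2025` takes it: `L₃(A,T)` separable over `ℚ`. A census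
certificate supplies integer polynomials `U, V` and `N ≠ 0` with `U·L₃ + V·L₃' = N` (extended Euclid,
exact); `separable_of_intBezout` turns the identity — checked by `ring` after `map_lPolynomialOfSurface_eq`
and `derivative_map_lPolynomialOfSurface_eq` put `L₃` and `L₃'` in numeral form — into `Separable`.
No claim about any surface is made here.

References: [BoxerCalegariGeePilloni2025] arXiv:2502.20645 Thm. 1.1.1 (3), Def. 9.1.2;
[BrumerEtAl2019] (4.1.5) (shape of `L_q`).
-/

noncomputable section

namespace Summit.Ventures.ResidMod

open Polynomial
open Literature.NumberTheory.FaltingsSerre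

/-- Cast form of `L_q(A,T)` over `ℚ`: `1 − aX + bX² − (qa)X³ + q²X⁴` with `a, b, q` cast into `ℚ[X]`
(numerals for concrete data, so that `ring` can check Bézout identities). [cite: BrumerEtAl2019, (4.1.5) p. 1164] -/
theorem map_lPolynomialOfSurface_eq (q : ℕ) (a b : ℤ) :
    (lPolynomialOfSurface q a b).map (Int.castRingHom ℚ) =
      1 - (a : ℚ[X]) * X + (b : ℚ[X]) * X ^ 2 - (q : ℚ[X]) * (a : ℚ[X]) * X ^ 3 + (q : ℚ[X]) ^ 2 * X ^ 4 := by
  simp only [lPolynomialOfSurface, Polynomial.map_add, Polynomial.map_sub, Polynomial.map_mul,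
    Polynomial.map_pow, Polynomial.map_X, Polynomial.map_one, eq_intCast, Int.cast_mul, Int.cast_pow,
    Int.cast_natCast, Polynomial.map_intCast, Polynomial.map_natCast]

/-- Cast form of the derivative `L_q'(T) = −a + 2bX − 3(qa)X² + 4q²X³`. [folklore] -/
theorem derivative_map_lPolynomialOfSurface_eq (q : ℕ) (a b : ℤ) :
    derivative ((lPolynomialOfSurface q a b).map (Int.castRingHom ℚ)) =
      -(a : ℚ[X]) + 2 * (b : ℚ[X]) * X - 3 * ((q : ℚ[X]) * (a : ℚ[X])) * X ^ 2 + 4 * (q : ℚ[X]) ^ 2 * X ^ 3 := by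
  rw [map_lPolynomialOfSurface_eq]
  simp only [derivative_add, derivative_sub, derivative_one, derivative_mul, derivative_intCast,
    derivative_natCast, derivative_X, derivative_pow, map_ofNat, Nat.cast_ofNat]
  push_cast
  ring

/-- **Separability from an integer Bézout identity**: if `U·P + V·P' = N` in `ℚ[X]` with `N ≠ 0` a
natural number, then `P` is separable (`(N⁻¹U)·P + (N⁻¹V)·P' = 1`). [folklore] -/
theorem separable_of_intBezout {P U V : ℚ[X]} {N : ℕ} (hN : N ≠ 0)
    (h : U * P + V * derivative P = (N : ℚ[X])) : P.Separable := by
  refine ⟨C ((N : ℚ)⁻¹) * U, C ((N : ℚ)⁻¹) * V, ?_⟩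
  rw [mul_assoc, mul_assoc, ← mul_add, h, ← map_natCast C N, ← C_mul,
    inv_mul_cancel₀ (Nat.cast_ne_zero.2 hN), C_1]

/-- Worked check of the kit on the Euler factor `L₃ = 1 + 2T + 4T² + 6T³ + 9T⁴` (`(a₃,b₃) = (−2,4)`,
the curve 353.a.353.1): `U = 146 − 288X − 72X²`, `V = 5 − 22X + 75X² + 18X³`, `N = 156`.
[cite: BoxerCalegariGeePilloni2025, Def. 9.1.2] -/
example : ((lPolynomialOfSurface 3 (-2) 4).map (Int.castRingHom ℚ)).Separable := by
  apply separable_of_intBezout (U := 146 - 288 * X - 72 * X ^ 2) (V := 5 - 22 * X + 75 * X ^ 2 + 18 * X ^ 3)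
    (N := 156) (by norm_num)
  rw [derivative_map_lPolynomialOfSurface_eq, map_lPolynomialOfSurface_eq]
  push_cast
  ring

end Summit.Ventures.ResidMod

end
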